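import Literature.Analysis.Hypoelliptic.KohnIterationX0
import HarnessLib

/-!
# Kohn's iteration, III: bracket words and the subelliptic bound for every iterated bracket

Analysis/Hypoelliptic support file, thirteenth piece of the Fourier-side toolkit serving the
discharge of `Literature.Analysis.Distribution.Hormander1967_thm11` by Kohn's method
(M. Taylor, *Pseudodifferential Operators* (1981), Ch. XV §1, (1.29)). Continues
`KohnIterationX0.lean`.

* `BWord J`: formal iterated brackets of the fields `X₀, X_1, …, X_J` (right-nested:
  `X_j`, `X₀`, `[X_j, w]`, `[X₀, w]`);
* `HData.fieldOf w`: the corresponding Fourier-side field, `BWord.expOf w > 0`: Kohn's exponent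
  (`1`, `1/2`, and halving, resp. quartering, for each further bracket with `X_j`, resp. `X₀`);
* **`HData.kohnS_fieldOf`**: `S(F_w, ε_w)` for every bracket word `w`, i.e.
  `‖F_w u‖_{ε_w - 1} ≤ C (‖P u‖₀ + ‖u‖₀)` for all `u ∈ Nice` — the induction of Taylor (1.29)
  assembled from the base cases and the two steps of `KohnIteration*.lean`.

## References

* M. E. Taylor, *Pseudodifferential Operators* (1981), Ch. XV §1, (1.29), (1.32), (1.50), (1.52).
-/

noncomputable section

open MeasureTheory Set Filter Function
open scoped ENNReal NNReal Topology ComplexConjugate InnerProductSpace BigOperators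

namespace Literature.Analysis.Hypoelliptic

/-- **Bracket words**: formal right-nested iterated brackets of `X₀, X_1, …, X_J`. [folklore] -/
inductive BWord (J : ℕ) : Type
  /-- the field `X_j` [folklore] -/
  | base (j : Fin J) : BWord J
  /-- the field `X₀` [folklore] -/
  | base0 : BWord J
  /-- the bracket `[X_j, w]` [folklore] -/
  | consJ (j : Fin J) (w : BWord J) : BWord J
  /-- the bracket `[X₀, w]` [folklore] -/
  | cons0 (w : BWord J) : BWord J

namespace BWord

variable {J : ℕ}

/-- **Kohn's exponent** of a bracket word: `1` for `X_j`, `1/2` for `X₀`, halved by each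
bracket with an `X_j`, quartered by each bracket with `X₀`. [folklore] -/
def expOf : BWord J → ℝ
  | base _ => 1
  | base0 => 1 / 2
  | consJ _ w => expOf w / 2
  | cons0 w => expOf w / 4

/-- Kohn's exponents are positive. [folklore] -/
theorem expOf_pos : ∀ w : BWord J, 0 < expOf w
  | base _ => one_pos
  | base0 => by norm_num [expOf]
  | consJ _ w => by have := expOf_pos w; simp only [expOf]; linarith
  | cons0 w => by have := expOf_pos w; simp only [expOf]; linarith

/-- Kohn's exponents are at most `1`. [folklore] -/
theorem expOf_le_one : ∀ w : BWord J, expOf w ≤ 1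
  | base _ => le_rfl
  | base0 => by norm_num [expOf]
  | consJ _ w => by have := expOf_le_one w; have := expOf_pos w; simp only [expOf]; linarith
  | cons0 w => by have := expOf_le_one w; have := expOf_pos w; simp only [expOf]; linarith

/-- The length (number of fields) of a bracket word. [folklore] -/
def len : BWord J → ℕ
  | base _ => 1
  | base0 => 1
  | consJ _ w => len w + 1
  | cons0 w => len w + 1

/-- `expOf w ≥ 4^{-len w}·2`: a crude lower bound. [folklore] -/
theorem expOf_ge : ∀ w : BWord J, 2 * (1 / 4 : ℝ) ^ len w ≤ expOf w
  | base _ => by norm_num [expOf, len]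
  | base0 => by norm_num [expOf, len]
  | consJ _ w => by
    have := expOf_ge w; have := expOf_pos w
    simp only [expOf, len, pow_succ]; nlinarith
  | cons0 w => by
    have := expOf_ge w; have := expOf_pos w
    simp only [expOf, len, pow_succ]; nlinarith

end BWord

namespace HData

open Sym Field BWord

variable {V : Type*} [NormedAddCommGroup V] [InnerProductSpace ℝ V] [FiniteDimensional ℝ V]
  [MeasurableSpace V] [BorelSpace V]

variable (d : HData V)

/-- The Fourier-side field of a bracket word. [folklore] -/
def fieldOf : BWord d.J → Field V
  | BWord.base j => d.X j
  | BWord.base0 => d.X0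
  | BWord.consJ j w => bracket (d.X j) (fieldOf w)
  | BWord.cons0 w => bracket d.X0 (fieldOf w)

omit [FiniteDimensional ℝ V] [BorelSpace V] in
/-- The fields of bracket words are syntactic fields. [folklore] -/
theorem isField_fieldOf : ∀ w : BWord d.J, IsField (d.fieldOf w)
  | BWord.base j => d.isField j
  | BWord.base0 => d.isField0
  | BWord.consJ j w => (d.isField j).bracket (isField_fieldOf w)
  | BWord.cons0 w => d.isField0.bracket (isField_fieldOf w)

omit [FiniteDimensional ℝ V] in
/-- The fields of bracket words are certified. [folklore] -/
theorem certF_fieldOf : ∀ w : BWord d.J, CertF (d.fieldOf w)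
  | BWord.base j => d.certF j
  | BWord.base0 => d.certF0
  | BWord.consJ j w => (d.certF j).bracket (d.isField j) (d.isField_fieldOf w) (certF_fieldOf w)
  | BWord.cons0 w => d.certF0.bracket d.isField0 (d.isField_fieldOf w) (certF_fieldOf w)

omit [FiniteDimensional ℝ V] [BorelSpace V] in
/-- The fields of bracket words are real. [folklore] -/
theorem isReal_fieldOf : ∀ w : BWord d.J, IsReal (d.fieldOf w)
  | BWord.base j => d.isReal j
  | BWord.base0 => d.isReal0
  | BWord.consJ j w => (d.isReal j).bracket (isReal_fieldOf w)
  | BWord.cons0 w => d.isReal0.bracket (isReal_fieldOf w)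

omit [FiniteDimensional ℝ V] [BorelSpace V] in
/-- The fields of bracket words are nonempty lists. [folklore] -/
theorem fieldOf_ne_nil : ∀ w : BWord d.J, d.fieldOf w ≠ []
  | BWord.base j => d.ne j
  | BWord.base0 => d.ne0
  | BWord.consJ j w => bracket_ne_nil (d.ne j) (fieldOf_ne_nil w)
  | BWord.cons0 w => bracket_ne_nil d.ne0 (fieldOf_ne_nil w)

/-- **Kohn's subelliptic bound for every iterated bracket** (Taylor 1981, (1.29)):
`S(F_w, ε_w)`, i.e. `‖F_w u‖_{ε_w - 1} ≤ C (‖P u‖₀ + ‖u‖₀)` for `u ∈ Nice` (Fourier-side form,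
with `ε` halved per `X_j`-bracket and quartered per `X₀`-bracket). [cite: Taylor1981, Ch. XV §1 (1.29)] -/
theorem kohnS_fieldOf : ∀ w : BWord d.J, d.KohnS (d.fieldOf w) (expOf w)
  | BWord.base j => d.kohnS_X j
  | BWord.base0 => d.kohnS_X0
  | BWord.consJ j w =>
    d.stepJ j (d.isField_fieldOf w) (d.certF_fieldOf w) (d.isReal_fieldOf w) (d.fieldOf_ne_nil w)
      (expOf_pos w) (expOf_le_one w) (kohnS_fieldOf w)
  | BWord.cons0 w =>
    d.stepX0 (d.isField_fieldOf w) (d.certF_fieldOf w) (d.isReal_fieldOf w) (d.fieldOf_ne_nil w)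
      (expOf_pos w) (expOf_le_one w) (kohnS_fieldOf w)

/-- The subelliptic bound in unpacked form. [folklore] -/
theorem rn_fieldOf_le (w : BWord d.J) : ∃ C : ℝ, 0 ≤ C ∧ ∀ u : V → ℂ, Nice u →
    rn (expOf w - 1) ((toSym (d.fieldOf w)).apply u) ≤ C * (rn 0 (d.opP.apply u) + rn 0 u) :=
  d.kohnS_fieldOf w

end HData

end Literature.Analysis.Hypoelliptic
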